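import Mathlib
import HarnessLib

/-!
# Format C: the odd-sector Hilbert part `(1/(n+m))_{n,m>M₁}` — weighted Schur test absorbed into the diagonal

Route context: Fourier–Galerkin / Schur-complement certificates of Weil positivity on a window ("format C";
cell memo `run/shared/lean/pub/rh-explicit/rh-explicit-weil-10/FORMATC-DESIGN.md` §4.3, DIG_off, odd sector;
supporting stmt-RiemannHypothesis-0098).  In the odd sector the off-diagonal digamma part of the far Gram contains
`−½·(1/(n+m))_{n,m>M₁}` (a Hilbert-type matrix, NOT droppable by sign).  §4.3 bounds it by the weighted Schur test
with weights `w_n = n^{−1/2}`:  `Σ_{m>M₁} m^{−1/2}/(n+m) ≤ ∫_{M₁}^{∞} dt/((n+t)√t) = (2/√n)(π/2 − arctan √(M₁/n))`, hence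
`|Σ_{n,m} y_n y_m/(n+m)| ≤ Σ_n 2(π/2 − arctan √(M₁/n))·y_n²` — a DIAGONAL majorant `h(n)` that the growing archimedean
diagonal `Re ψ(¼ + iω_n/2)` absorbs (this is the `−h(m)` in the odd `d̂_m` of §4.10).  This file proves exactly that, for
finite truncations `M₁ < n, m ≤ N`:

* `WeilFormatC.abs_quadForm_le_diag_of_schurWeights` — weighted Schur test in diagonal form: `|E i j| ≤ K i j`,
  `K` symmetric, `w > 0` ⟹ `|Σ x_i E_ij x_j| ≤ Σ_i (w_i⁻¹ Σ_j K_ij w_j)·x_i²`;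
* `WeilFormatC.sum_inv_sqrt_div_add_le` — `Σ_{m=M₁+1}^{N} m^{−1/2}/(n+m) ≤ (2/√n)(π/2 − arctan √(M₁/n))` (`1 ≤ M₁ ≤ N`, `0 < n`);
* `WeilFormatC.abs_hilbertPart_le` — for `y` on the modes `M₁ < n ≤ N`:
  **`|Σ_n Σ_m y_n y_m/(n+m)| ≤ Σ_n 2(π/2 − arctan √(M₁/n)) · y_n²`.**

Elementary (`Finset` sums, one `arctan ∘ sqrt` primitive, antitone sum–integral comparison); standard axioms only.
-/

-- `Summit.RiemannHypothesis.RiemannHypothesis.…` is the layout-mandated namespace (summit = problem name).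
set_option linter.dupNamespace false

noncomputable section

open Finset MeasureTheory Set intervalIntegral
open scoped Real

namespace Summit.RiemannHypothesis.RiemannHypothesis.Theorems.WeilFormatC

/-! ### Weighted Schur test, diagonal form -/

/-- **Weighted Schur test, diagonal form.**  If `|E i j| ≤ K i j` with `K` symmetric and nonnegative and `w i > 0`, then
`|Σ_i Σ_j x_i E_ij x_j| ≤ Σ_i (w_i⁻¹ · Σ_j K_ij w_j) · x_i²` (termwise `|x_i|K_ij|x_j| ≤ ½K_ij(w_j/w_i x_i² + w_i/w_j x_j²)`,
then symmetry). -/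
theorem abs_quadForm_le_diag_of_schurWeights {ι : Type*} (s : Finset ι) (E K : ι → ι → ℝ) (w : ι → ℝ)
    (x : ι → ℝ) (hE : ∀ i ∈ s, ∀ j ∈ s, |E i j| ≤ K i j) (hK : ∀ i ∈ s, ∀ j ∈ s, K i j = K j i)
    (hw : ∀ i ∈ s, 0 < w i) :
    |∑ i ∈ s, ∑ j ∈ s, x i * E i j * x j| ≤ ∑ i ∈ s, ((w i)⁻¹ * ∑ j ∈ s, K i j * w j) * x i ^ 2 := by
  have hK0 : ∀ i ∈ s, ∀ j ∈ s, 0 ≤ K i j := fun i hi j hj ↦ (abs_nonneg _).trans (hE i hi j hj)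
  have hterm : ∀ i ∈ s, ∀ j ∈ s,
      |x i * E i j * x j| ≤ K i j / 2 * (w j / w i * x i ^ 2 + w i / w j * x j ^ 2) := by
    intro i hi j hj
    rw [abs_mul, abs_mul]
    have hwi := hw i hi; have hwj := hw j hj
    have h1 : |x i| * |E i j| * |x j| ≤ |x i| * K i j * |x j| := by gcongr; exact hE i hi j hj
    refine h1.trans ?_
    -- `2|x_i||x_j| ≤ w_j/w_i x_i² + w_i/w_j x_j²`
    have h0 : 0 ≤ (w j * |x i| - w i * |x j|) ^ 2 := sq_nonneg _
    have h0' : 0 ≤ w j ^ 2 * x i ^ 2 - 2 * (w i * w j) * (|x i| * |x j|) + w i ^ 2 * x j ^ 2 := by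
      have e : (w j * |x i| - w i * |x j|) ^ 2
          = w j ^ 2 * |x i| ^ 2 - 2 * (w i * w j) * (|x i| * |x j|) + w i ^ 2 * |x j| ^ 2 := by ring
      rw [e, sq_abs, sq_abs] at h0; exact h0
    have key : 2 * (|x i| * |x j|) ≤ w j / w i * x i ^ 2 + w i / w j * x j ^ 2 := by
      rw [div_mul_eq_mul_div, div_mul_eq_mul_div, div_add_div _ _ hwi.ne' hwj.ne', le_div_iff₀ (mul_pos hwi hwj)]
      nlinarith [h0']
    nlinarith [key, hK0 i hi j hj]
  have h1 : |∑ i ∈ s, ∑ j ∈ s, x i * E i j * x j|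
      ≤ ∑ i ∈ s, ∑ j ∈ s, K i j / 2 * (w j / w i * x i ^ 2 + w i / w j * x j ^ 2) := by
    refine (Finset.abs_sum_le_sum_abs _ _).trans (Finset.sum_le_sum fun i hi ↦ ?_)
    exact (Finset.abs_sum_le_sum_abs _ _).trans (Finset.sum_le_sum fun j hj ↦ hterm i hi j hj)
  refine h1.trans (le_of_eq ?_)
  have hsplit : ∑ i ∈ s, ∑ j ∈ s, K i j / 2 * (w j / w i * x i ^ 2 + w i / w j * x j ^ 2)
      = (∑ i ∈ s, ∑ j ∈ s, K i j / 2 * (w j / w i * x i ^ 2)) + ∑ i ∈ s, ∑ j ∈ s, K i j / 2 * (w i / w j * x j ^ 2) := by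
    rw [← Finset.sum_add_distrib]
    refine Finset.sum_congr rfl fun i _ ↦ ?_
    rw [← Finset.sum_add_distrib]
    refine Finset.sum_congr rfl fun j _ ↦ by ring
  have hswap : ∑ i ∈ s, ∑ j ∈ s, K i j / 2 * (w i / w j * x j ^ 2)
      = ∑ i ∈ s, ∑ j ∈ s, K i j / 2 * (w j / w i * x i ^ 2) := by
    rw [Finset.sum_comm]
    refine Finset.sum_congr rfl fun i hi ↦ Finset.sum_congr rfl fun j hj ↦ ?_
    rw [hK j hj i hi]
  rw [hsplit, hswap, ← two_mul, Finset.mul_sum]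
  refine Finset.sum_congr rfl fun i hi ↦ ?_
  rw [Finset.mul_sum, Finset.mul_sum, Finset.sum_mul]
  refine Finset.sum_congr rfl fun j _ ↦ ?_
  have hwi := (hw i hi).ne'
  field_simp

/-! ### The kernel sum `Σ_m m^{-1/2}/(n+m)` -/

/-- The primitive: for `0 < n` and `0 < t`, `d/dt [(2/√n)·arctan(√t/√n)] = 1/((n+t)√t)`. -/
theorem hasDerivAt_arctan_sqrt_div {n t : ℝ} (hn : 0 < n) (ht : 0 < t) :
    HasDerivAt (fun t : ℝ ↦ 2 / Real.sqrt n * Real.arctan (Real.sqrt t / Real.sqrt n))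
      (1 / ((n + t) * Real.sqrt t)) t := by
  have hsn : 0 < Real.sqrt n := Real.sqrt_pos.mpr hn
  have hst : 0 < Real.sqrt t := Real.sqrt_pos.mpr ht
  have h1 : HasDerivAt (fun t : ℝ ↦ Real.sqrt t / Real.sqrt n) (1 / (2 * Real.sqrt t) / Real.sqrt n) t :=
    (Real.hasDerivAt_sqrt ht.ne').div_const _
  have h2 := ((Real.hasDerivAt_arctan _).comp t h1).const_mul (2 / Real.sqrt n)
  refine h2.congr_deriv ?_
  have hsq : Real.sqrt t ^ 2 = t := Real.sq_sqrt ht.le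
  have hsqn : Real.sqrt n ^ 2 = n := Real.sq_sqrt hn.le
  field_simp
  rw [hsqn, hsq]

/-- `∫_{A}^{B} dt/((n+t)√t) = (2/√n)(arctan √(B/n)·… )` in the form we use:
for `0 < n`, `0 < A ≤ B`, `∫_A^B 1/((n+t)√t) dt = (2/√n)(arctan(√B/√n) − arctan(√A/√n))`. -/
theorem integral_inv_add_mul_sqrt {n A B : ℝ} (hn : 0 < n) (hA : 0 < A) (hAB : A ≤ B) :
    ∫ t in A..B, 1 / ((n + t) * Real.sqrt t)
      = 2 / Real.sqrt n * (Real.arctan (Real.sqrt B / Real.sqrt n) - Real.arctan (Real.sqrt A / Real.sqrt n)) := by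
  have hderiv : ∀ t ∈ uIcc A B,
      HasDerivAt (fun t : ℝ ↦ 2 / Real.sqrt n * Real.arctan (Real.sqrt t / Real.sqrt n))
        (1 / ((n + t) * Real.sqrt t)) t := by
    intro t ht
    rw [uIcc_of_le hAB] at ht
    exact hasDerivAt_arctan_sqrt_div hn (lt_of_lt_of_le hA ht.1)
  have hcont : ContinuousOn (fun t : ℝ ↦ 1 / ((n + t) * Real.sqrt t)) (uIcc A B) := by
    rw [uIcc_of_le hAB]
    refine ContinuousOn.div continuousOn_const (by fun_prop) fun t ht ↦ ?_
    have : 0 < t := lt_of_lt_of_le hA ht.1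
    positivity
  rw [integral_eq_sub_of_hasDerivAt hderiv hcont.intervalIntegrable]
  ring

/-- **`Σ_{m=M₁+1}^{N} m^{−1/2}/(n+m) ≤ (2/√n)(π/2 − arctan √(M₁/n))`** for `0 < n`, `1 ≤ M₁ ≤ N`
(antitone comparison with `∫_{M₁}^{N} dt/((n+t)√t)`, then `arctan ≤ π/2`). -/
theorem sum_inv_sqrt_div_add_le {n : ℝ} (hn : 0 < n) {M₁ N : ℕ} (hM : 1 ≤ M₁) (hMN : M₁ ≤ N) :
    ∑ m ∈ Finset.Ioc M₁ N, 1 / ((n + m) * Real.sqrt m)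
      ≤ 2 / Real.sqrt n * (π / 2 - Real.arctan (Real.sqrt M₁ / Real.sqrt n)) := by
  set f : ℝ → ℝ := fun t ↦ 1 / ((n + t) * Real.sqrt t) with hf
  have hM0 : (0 : ℝ) < M₁ := by exact_mod_cast hM
  have hanti : AntitoneOn f (Icc (M₁ : ℝ) N) := by
    intro u hu v hv huv
    simp only [hf]
    have hu0 : 0 < u := lt_of_lt_of_le hM0 hu.1
    have hv0 : 0 < v := lt_of_lt_of_le hM0 hv.1
    apply one_div_le_one_div_of_le (by positivity)
    gcongr
  -- Σ_{i ∈ Ico M₁ N} f(i+1) ≤ ∫_{M₁}^{N} f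
  have hcmp := AntitoneOn.sum_le_integral_Ico hMN hanti
  -- reindex Ioc M₁ N as (Ico M₁ N).image (+1)
  have hre : ∑ m ∈ Finset.Ioc M₁ N, f m = ∑ i ∈ Finset.Ico M₁ N, f ((i + 1 : ℕ) : ℝ) := by
    have : Finset.Ioc M₁ N = Finset.image (fun i ↦ i + 1) (Finset.Ico M₁ N) := by
      ext m
      simp only [Finset.mem_Ioc, Finset.mem_image, Finset.mem_Ico]
      constructor
      · intro h; exact ⟨m - 1, by omega, by omega⟩
      · rintro ⟨i, hi, rfl⟩; omega
    rw [this, Finset.sum_image (fun i _ j _ h ↦ by simpa using h)]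
  have hsum : ∑ m ∈ Finset.Ioc M₁ N, 1 / ((n + m) * Real.sqrt m) = ∑ m ∈ Finset.Ioc M₁ N, f m := by
    simp [hf]
  rw [hsum, hre]
  refine hcmp.trans ?_
  simp only [hf]
  rw [integral_inv_add_mul_sqrt hn hM0 (by exact_mod_cast hMN)]
  have hsn : 0 < Real.sqrt n := Real.sqrt_pos.mpr hn
  have h2 : 0 ≤ 2 / Real.sqrt n := by positivity
  apply mul_le_mul_of_nonneg_left _ h2
  linarith [Real.arctan_lt_pi_div_two (Real.sqrt N / Real.sqrt n)]

/-! ### The Hilbert part bound -/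

/-- **The odd-sector Hilbert part, absorbed into the diagonal.**  For every `1 ≤ M₁ ≤ N` and every real `y` on the
modes `M₁ < n ≤ N`:  `|Σ_n Σ_m y_n y_m /(n+m)| ≤ Σ_n 2(π/2 − arctan √(M₁/n))·y_n²`
(weighted Schur test with `w_n = n^{−1/2}` and `sum_inv_sqrt_div_add_le`). -/
theorem abs_hilbertPart_le {M₁ N : ℕ} (hM : 1 ≤ M₁) (hMN : M₁ ≤ N) (y : ℕ → ℝ) :
    |∑ n ∈ Finset.Ioc M₁ N, ∑ m ∈ Finset.Ioc M₁ N, y n * (1 / ((n : ℝ) + m)) * y m|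
      ≤ ∑ n ∈ Finset.Ioc M₁ N, 2 * (π / 2 - Real.arctan (Real.sqrt M₁ / Real.sqrt n)) * y n ^ 2 := by
  set s := Finset.Ioc M₁ N with hs
  have hpos : ∀ i ∈ s, (0 : ℝ) < i := fun i hi ↦ by
    have : M₁ < i := (Finset.mem_Ioc.mp hi).1
    exact_mod_cast (lt_of_lt_of_le (Nat.lt_of_lt_of_le Nat.zero_lt_one hM) this.le)
  have h := abs_quadForm_le_diag_of_schurWeights s (fun i j ↦ 1 / ((i : ℝ) + j)) (fun i j ↦ 1 / ((i : ℝ) + j))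
    (fun i ↦ 1 / Real.sqrt i) y (fun i _ j _ ↦ ?_) (fun i _ j _ ↦ by rw [add_comm]) (fun i hi ↦ by
      have := hpos i hi; positivity)
  · refine h.trans (Finset.sum_le_sum fun i hi ↦ ?_)
    have hi0 := hpos i hi
    have hsq : 0 < Real.sqrt i := Real.sqrt_pos.mpr hi0
    apply mul_le_mul_of_nonneg_right _ (sq_nonneg _)
    -- `(1/√i)⁻¹ · Σ_j (1/(i+j)) (1/√j) ≤ 2(π/2 − arctan √(M₁/i))`
    have hk : ∑ j ∈ s, 1 / ((i : ℝ) + j) * (1 / Real.sqrt j) = ∑ j ∈ s, 1 / (((i : ℝ) + j) * Real.sqrt j) := by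
      refine Finset.sum_congr rfl fun j _ ↦ by rw [one_div_mul_one_div]
    rw [hk, one_div, inv_inv]
    have hb := sum_inv_sqrt_div_add_le hi0 hM hMN
    calc Real.sqrt i * ∑ j ∈ s, 1 / (((i : ℝ) + j) * Real.sqrt j)
        ≤ Real.sqrt i * (2 / Real.sqrt i * (π / 2 - Real.arctan (Real.sqrt M₁ / Real.sqrt i))) :=
          mul_le_mul_of_nonneg_left hb hsq.le
      _ = 2 * (π / 2 - Real.arctan (Real.sqrt M₁ / Real.sqrt i)) := by field_simp
  · -- `|1/(i+j)| ≤ 1/(i+j)`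
    have : (0 : ℝ) ≤ 1 / ((i : ℝ) + j) := by positivity
    rw [abs_of_nonneg this]

end Summit.RiemannHypothesis.RiemannHypothesis.Theorems.WeilFormatC
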